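import Literature.NumberTheory.EllipticCurves.Kato2004.IwasawaH1ReductionRoots
import HarnessLib

/-!
# Kato 2004 (Astérisque 295) Thm. 12.4 (2), the `p`-part: the pinned Iwasawa cohomology
# `𝐇¹_Γ(T_pW) = lim←_n H¹(ℤ_n[1/p], T_pW)` has NO `p`-TORSION — every elliptic `E/ℚ`, every prime
# `p`, every `ℤ_p`-extension

Topic `NumberTheory/EllipticCurves`, sub-directory `Kato2004` (namespace = path).  THEOREMS ONLY (no
definition, no named fact, no `sorry`).  Cell `bsd-potss` (seat `bsd-potss-rkm`, crux M = item 19196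
`ReducibleKatoMember`, whose held input `Kato2004.exists_memberHullInputs` carries the clause
`torsionFree_H : NoZeroSMulDivisors Λ 𝐇¹_Γ` = Kato Thm. 12.4 (2)); the present file proves the
`p`-power part of that clause UNCONDITIONALLY on the pin `Kato2004.IwasawaH1Data` (K6's currency):

* `Literature.NumberTheory.GaloisRepresentations.coresLe_resLe` — **`cor_{H'/H} ∘ res_{H/H'} =
  (H' : H)`** on `H¹_cont` for subgroups `H ≤ H'` (the relative form of the tree's `cores_resSubgroup`;
  Serre, *Galois Cohomology*, I §2.4 Prop. 9).
* `Kato2004.exists_forall_layerCores_eq_zero_of_prime_smul_eq_zero` — for `E/ℚ`, `p`, a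
  `ℤ_p`-extension `κ` with layers `Γ_n = Gal(ℚ̄/ℚ_n)`: there is `n₀` such that for all `n ≥ n₀` the
  trace map `Cor : H¹(ℚ_{n+1}, T_pW) → H¹(ℚ_n, T_pW)` KILLS the `p`-torsion `H¹(ℚ_{n+1}, T_pW)[p]`.
  Proof: `W[p]^{Γ_n}` is an increasing chain in the finite `W[p]`, so constant for `n ≥ n₀`; a
  `p`-torsion class `y = [c]` at level `n + 1` has `p c = ∂m`, `m ∈ T_pW`, whose reduction
  `P = m mod p` is `Γ_{n+1}`-fixed, hence `Γ_n`-fixed; so `g ↦ p⁻¹(g m − m)` is a continuous cocycle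
  `d` on `Γ_n` (the cochain engine `exists_cocycle_prime_nsmul_eq` of `IwasawaH1ReductionRoots`)
  with `res [d] = y` and `p [d] = [∂m] = 0`, whence `Cor y = Cor res [d] = (Γ_n : Γ_{n+1}) [d] =
  p [d] = 0` (`coresLe_resLe`, `ZpExtension.index_layerSubgroup`).
* **`Kato2004.IwasawaH1Data.eq_zero_of_prime_nsmul_eq_zero`** — for every pin
  `I : IwasawaH1Data W p κ γ` and `x ∈ 𝐇¹_Γ`, `p • x = 0 → x = 0`; with the corollaries
  `…eq_zero_of_prime_pow_nsmul_eq_zero` (`p^k • x = 0 → x = 0`) and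
  `…eq_zero_of_C_prime_smul_eq_zero` (`C(p) • x = 0 → x = 0` for the constant `p ∈ Λ = ℤ_p⟦T⟧`).
  Proof: the components `x_n = proj n x` are norm-compatible `p`-torsion classes, so `x_n =
  Cor x_{n+1} = 0` for `n ≥ n₀`, then downwards for all `n`, and `proj` is injective.

What is NOT here: the `Λ`-torsion part of Thm. 12.4 (2) (a class killed by a distinguished
polynomial), which is `𝐇¹_{Λ-tors} ≅ T_p(E(ℚ_∞)[p^∞]) = 0` and needs, besides the finiteness of
`E(ℚ_∞)[p^∞]` (the tree's `WeierstrassCurve.finite_fixedPoints_kerSubgroup_geomPrimaryTorsion_rat`,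
`IwasawaTowerTorsionFiniteProofs`), the structure theory of `𝐇¹` over `Λ` (Kato (12.2.2)).

## The printed statement (K. Kato, Astérisque 295 (2004))

* **Thm. 12.4 (2) [p. 222]** "`𝐇¹(T)` is a torsion free `Λ`-module" (for `T ⊂ V_{O_λ}(f)` a
  `Gal`-stable lattice; here `T = T_pW`, `O_λ = ℤ_p`, Δ-trivial component); proof **§13.8 [pp. 228–229]**
  via `𝐇¹(T)/x𝐇¹(T) ⊂ H¹(ℤ[1/p], T ⊗ Λ/xΛ)` and `lim← H⁰`.
* **§12.2 [p. 220]** the inverse limit "with respect to trace maps".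

## References

* [Kato2004Asterisque] K. Kato, *p-adic Hodge theory and values of zeta functions of modular forms*,
  Astérisque 295 (2004), Thm. 12.4 (2) (p. 222), §12.2 (p. 220), §13.8 (pp. 228–229).
* [SerreGaloisCohomology1997] J.-P. Serre, *Galois Cohomology* (1997), I §2.2 (cochains), I §2.4
  Prop. 9 (`Cor ∘ Res = (G : H)`).
-/

noncomputable section

open scoped NumberField
open Field CategoryTheory
open Literature.NumberTheory.GaloisRepresentations
open Literature.NumberTheory.EllipticCurves Literature.NumberTheory.EllipticCurves.Kato2004
open Literature.NumberTheory.EllipticCurves.Kato2004.EulerSystemValues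
open WeierstrassCurve (geomPoints geomTorsion)

universe u v

/-! ## `cor ∘ res = (H' : H)` in the relative setting -/

namespace Literature.NumberTheory.GaloisRepresentations

section CorRes

variable {R : Type u} [Ring R] [TopologicalSpace R]
variable {G : Type v} [Group G] [TopologicalSpace G] [IsTopologicalGroup G]
variable (X : TopRep.{v} R G) {H H' : Subgroup G}

/-- **`cor_{H'/H} ∘ res = (H' : H)` on `H¹_cont(H', X)`** for subgroups `H ≤ H'` of `G` with `H` open
and of finite index in `H'`: the relative corestriction `coresLe` of the tree composed with the
restriction `resLe` is multiplication by the index (the tree's `cores_resSubgroup` for the group `H'`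
and its subgroup `H.subgroupOf H'`, transported along the tautological pull-backs). Serre, *Galois
Cohomology* (1997), I §2.4, Prop. 9. [cite: SerreGaloisCohomology1997, I §2.4 Prop. 9] -/
theorem coresLe_resLe (h : H ≤ H') (hH : IsOpen (H : Set G)) [Fintype (H' ⧸ H.subgroupOf H')]
    (η : continuousCohomology 1 (subgroupRep X H')) :
    coresLe X h hH (resLe X h 1 η) = ((H.subgroupOf H').index : R) • η := by
  obtain ⟨f, rfl⟩ := oneCocycleClass_surjective _ η
  rw [← cores_resSubgroup (subgroupRep X H') (H.subgroupOf H') (isOpen_subgroupOf H' hH),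
    resLe_oneCocycleClass, resSubgroup_oneCocycleClass, coresLe, LinearMap.coe_comp,
    Function.comp_apply, ContinuousLinearMap.coe_coe]
  change cores _ _ _ (toSubgroupOf X h 1 (oneCocycleClass _ _)) = _
  rw [toSubgroupOf, map_oneCocycleClass]
  congr 1

/-- **Restriction on cocycles, pointwise form**: if a cocycle `d` on `H'` agrees with a cocycle `c`
on the subgroup `H ≤ H'` (`d|_H = c` pointwise), then `res [d] = [c]` (Serre, *Galois Cohomology*,
I §2.4: `res [φ] = [φ|_H]`, the tree's `resLe_oneCocycleClass`). Stated for an abstract `TopRep` so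
that instances at concrete representations are kernel-cheap. [cite: SerreGaloisCohomology1997, I §2.4] -/
theorem resLe_oneCocycleClass_eq_of_forall_apply (h : H ≤ H')
    (d : contOneCocycles (subgroupRep X H')) (c : contOneCocycles (subgroupRep X H))
    (hdc : ∀ g : H, d.1 (subgroupInclusion h g) = c.1 g) :
    resLe X h 1 (oneCocycleClass _ d) = oneCocycleClass _ c := by
  rw [resLe_oneCocycleClass]
  congr 1
  refine Subtype.ext (ContinuousMap.ext fun g ↦ ?_)
  rw [contOneCocycles.pullback_apply, TopRep.hom_ofHom, ← hdc g]
  rfl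

end CorRes

end Literature.NumberTheory.GaloisRepresentations

namespace Literature.NumberTheory.EllipticCurves.Kato2004

variable (W : WeierstrassCurve ℚ) [W.IsElliptic] (p : ℕ) [Fact p.Prime]
  [ContinuousSMul ℤ_[p] (W.tateModule p)] (κ : ZpExtension ℚ p)

/-! ## The trace map kills the `p`-torsion of `H¹(ℚ_{n+1}, T_pW)` for `n ≫ 0` -/

omit [ContinuousSMul ℤ_[p] (W.tateModule p)] in
/-- **Stabilisation of `W[p]^{Γ_n}`.** Along a `ℤ_p`-extension `κ` of `ℚ` with layers
`Γ_n = κ.layerSubgroup n`, the fixed sets `W[p]^{Γ_n}` increase with `n` inside the finite group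
`W[p]`, hence are constant from some `n₀` on: for `n ≥ n₀`, a point of `W[p]` fixed by `Γ_{n+1}` is
fixed by `Γ_n`. [cite: Kato2004Asterisque, §13.8 (p. 228)] -/
theorem exists_forall_smul_eq_of_layerSubgroup_succ :
    ∃ n₀ : ℕ, ∀ n, n₀ ≤ n → ∀ P : geomTorsion W (p : ℤ),
      (∀ g ∈ κ.layerSubgroup (n + 1), g • (P : geomPoints W) = P) →
        ∀ g ∈ κ.layerSubgroup n, g • (P : geomPoints W) = P := by
  haveI : NeZero p := ⟨(Fact.out : p.Prime).ne_zero⟩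
  haveI : Finite (geomTorsion W (p : ℤ)) := finite_geomTorsion_of_neZero W p
  -- the increasing chain `V n = W[p]^{Γ_n}` in the finite lattice `Set W[p]`
  let V : ℕ →o Set (geomTorsion W (p : ℤ)) :=
    { toFun := fun n ↦ {P | ∀ g ∈ κ.layerSubgroup n, g • (P : geomPoints W) = P}
      monotone' := fun n m hnm P hP g hg ↦ hP g (κ.layerSubgroup_antitone hnm hg) }
  obtain ⟨n₀, hn₀⟩ := WellFoundedGT.monotone_chain_condition V
  refine ⟨n₀, fun n hn P hP ↦ ?_⟩
  have hmem : P ∈ V (n + 1) := hP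
  rw [← hn₀ (n + 1) (hn.trans (Nat.le_succ n)), hn₀ n hn] at hmem
  exact hmem

/-- **For `n ≫ 0` the trace map `Cor : H¹(ℚ_{n+1}, T_pW) → H¹(ℚ_n, T_pW)` kills every `p`-torsion
class** (every `E/ℚ`, `p`, `ℤ_p`-extension `κ`). A class `y = [c]` with `p y = 0` has `p c = ∂m`
with `m mod p ∈ W[p]^{Γ_{n+1}} = W[p]^{Γ_n}` (`n ≥ n₀`, previous lemma), so `p⁻¹ ∂m` is a continuous
cocycle `d` on `Γ_n` (`exists_cocycle_prime_nsmul_eq`) with `res [d] = y` and `p [d] = 0`; then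
`Cor y = Cor res [d] = (Γ_n : Γ_{n+1}) [d] = p [d] = 0` (`coresLe_resLe`, `index_layerSubgroup`).
This is the levelwise content of Kato's proof of Thm. 12.4 (2) in §13.8 ("`lim← H⁰ = 0`").
[cite: Kato2004Asterisque, Thm. 12.4 (2) (p. 222) and §13.8 (pp. 228–229)] -/
theorem exists_forall_layerCores_eq_zero_of_prime_smul_eq_zero :
    ∃ n₀ : ℕ, ∀ n, n₀ ≤ n → ∀ y : H1 (tateRep W p) (κ.layerSubgroup (n + 1)),
      (p : ℤ_[p]) • y = 0 → layerCores (tateRep W p) κ n y = 0 := by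
  have hp : p.Prime := Fact.out
  obtain ⟨n₀, hn₀⟩ := exists_forall_smul_eq_of_layerSubgroup_succ W p κ
  refine ⟨n₀, fun n hn y hy ↦ ?_⟩
  have hle : κ.layerSubgroup (n + 1) ≤ κ.layerSubgroup n := κ.layerSubgroup_antitone (Nat.le_succ n)
  -- `y = [c]`, `p • c = ∂m`
  obtain ⟨c, hc⟩ := oneCocycleClass_surjective _ y
  have hy' : oneCocycleClass _ ((p : ℤ_[p]) • c) = 0 := by rw [oneCocycleClass_smul, hc]; exact hy
  rw [oneCocycleClass_eq_zero_iff] at hy'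
  obtain ⟨m, hm⟩ := hy'
  have hm' : ∀ g : (κ.layerSubgroup (n + 1)), p • c.1 g = (subgroupRep (tateRep W p).toTopRep (κ.layerSubgroup (n + 1))).ρ g m - m := fun g ↦ by
    rw [← hm g, Submodule.coe_smul, ContinuousMap.smul_apply, Nat.cast_smul_eq_nsmul]
  -- the reduction `P = m mod p` is `Γ_{n+1}`-fixed, hence `Γ_n`-fixed
  set P : geomTorsion W (p : ℤ) := tateModP W p m with hPdef
  have hPfix' : ∀ g : (κ.layerSubgroup (n + 1)), (g : absoluteGaloisGroup ℚ) • (P : geomPoints W) = P := fun g ↦ by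
    have h := congrArg (TateModule.proj p 1) (hm' g)
    rw [map_nsmul, map_sub] at h
    change p • TateModule.proj p 1 (c.1 g) =
      TateModule.proj p 1 ((g : absoluteGaloisGroup ℚ) • m) - TateModule.proj p 1 m at h
    rw [TateModule.proj_smul_of_distribMulAction] at h
    have h0 : p • TateModule.proj p 1 (c.1 g) = 0 := by
      have := TateModule.pow_smul_proj 1 (c.1 g); rwa [pow_one] at this
    rw [h0, eq_comm, sub_eq_zero] at h
    exact h
  have hPfix : ∀ g : (κ.layerSubgroup n), (g : absoluteGaloisGroup ℚ) • (P : geomPoints W) = P := fun g ↦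
    hn₀ n hn P (fun g hg ↦ hPfix' ⟨g, hg⟩) g g.2
  -- `d = p⁻¹ ∂m`, a continuous cocycle on `Γ_n`
  obtain ⟨hcont, hmul⟩ := continuous_coboundary_and_mul W p (κ.layerSubgroup n) m
  obtain ⟨d, hd⟩ := exists_cocycle_prime_nsmul_eq W p (κ.layerSubgroup n) _ hcont hmul fun g ↦ by
    rw [map_sub]
    change TateModule.proj p 1 ((g : absoluteGaloisGroup ℚ) • m) - _ = 0
    rw [TateModule.proj_smul_of_distribMulAction]
    change (g : absoluteGaloisGroup ℚ) • (P : geomPoints W) - (P : geomPoints W) = 0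
    rw [hPfix g, sub_self]
  -- `res [d] = [c]`
  have hdc : ∀ g : κ.layerSubgroup (n + 1), d.1 (subgroupInclusion hle g) = c.1 g := fun g ↦ by
    refine TateModule.eq_of_prime_nsmul_eq ?_
    rw [hd, hm', subgroupRep_ρ_apply, subgroupRep_ρ_apply, subgroupInclusion_apply_coe]
  have hres : resLe (tateRep W p).toTopRep hle 1 (oneCocycleClass _ d) = oneCocycleClass _ c :=
    resLe_oneCocycleClass_eq_of_forall_apply (tateRep W p).toTopRep hle d c hdc
  -- `p • [d] = [∂m] = 0`
  have hpd : (p : ℤ_[p]) • oneCocycleClass _ d = 0 := by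
    rw [← oneCocycleClass_smul, oneCocycleClass_eq_zero_iff]
    refine ⟨m, fun g ↦ ?_⟩
    rw [Submodule.coe_smul, ContinuousMap.smul_apply, Nat.cast_smul_eq_nsmul, hd g]
  -- `Cor [c] = Cor res [d] = (Γ_n : Γ_{n+1}) • [d] = p • [d] = 0`
  have hidx : ((κ.layerSubgroup (n + 1)).subgroupOf (κ.layerSubgroup n)).index = p := by
    have h1 := Subgroup.relIndex_mul_index hle
    rw [ZpExtension.index_layerSubgroup, ZpExtension.index_layerSubgroup, pow_succ'] at h1
    exact Nat.eq_of_mul_eq_mul_right (pow_pos hp.pos n) h1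
  rw [← hc, ← hres]
  unfold layerCores
  rw [coresLe_resLe, hidx]
  exact hpd

/-! ## `𝐇¹_Γ(T_pW)` has no `p`-torsion -/

variable {W p κ} {γ : absoluteGaloisGroup ℚ}

/-- **Kato Thm. 12.4 (2), `p`-part, on the pin: `𝐇¹_Γ(T_pW)` has no `p`-torsion.** For every
elliptic curve `E/ℚ`, prime `p`, `ℤ_p`-extension `κ` of `ℚ` and every datum
`I : IwasawaH1Data W p κ γ` (`𝐇¹_Γ = lim←_n H¹(ℤ_n[1/p], T_pW)` along the trace maps), an element
`x` with `p • x = 0` is `0`: its components `x_n = proj n x` are norm-compatible `p`-torsion classes,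
so `x_n = Cor x_{n+1} = 0` for `n ≥ n₀` (`exists_forall_layerCores_eq_zero_of_prime_smul_eq_zero`),
hence for all `n` (downwards along `Cor`), and `(proj n)_n` is injective. Kato, Astérisque 295,
Thm. 12.4 (2) "`𝐇¹(T)` is a torsion free `Λ`-module" — the part concerning the constant `p ∈ Λ`.
[cite: Kato2004Asterisque, Thm. 12.4 (2) (p. 222) and §13.8 (pp. 228–229)] -/
theorem IwasawaH1Data.eq_zero_of_prime_nsmul_eq_zero (I : IwasawaH1Data W p κ γ) (x : I.H)
    (hx : p • x = 0) : x = 0 := by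
  obtain ⟨n₀, hn₀⟩ := exists_forall_layerCores_eq_zero_of_prime_smul_eq_zero W p κ
  -- every component is `p`-torsion
  have htors : ∀ n, (p : ℤ_[p]) • I.proj n x = 0 := fun n ↦ by
    rw [Nat.cast_smul_eq_nsmul, ← map_nsmul, hx, map_zero]
  -- components vanish from `n₀` on, then everywhere (downwards along the trace maps)
  have hge : ∀ n, n₀ ≤ n → I.proj n x = 0 := fun n hn ↦ by
    rw [← I.cores_proj n x]
    exact hn₀ n hn _ (htors (n + 1))
  have hall : ∀ m n, n₀ ≤ n + m → I.proj n x = 0 := by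
    intro m
    induction m with
    | zero => exact fun n hn ↦ hge n (by simpa using hn)
    | succ m ih =>
      intro n hn
      rw [← I.cores_proj n x, ih (n + 1) (by omega), map_zero]
  exact I.proj_injective x fun n ↦ hall n₀ n (Nat.le_add_left n₀ n)

/-- **No `p^k`-torsion in `𝐇¹_Γ(T_pW)`**: `p^k • x = 0 → x = 0` (induction on `k`).
[cite: Kato2004Asterisque, Thm. 12.4 (2) (p. 222)] -/
theorem IwasawaH1Data.eq_zero_of_prime_pow_nsmul_eq_zero (I : IwasawaH1Data W p κ γ) (k : ℕ)
    (x : I.H) (hx : p ^ k • x = 0) : x = 0 := by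
  induction k generalizing x with
  | zero => rwa [pow_zero, one_smul] at hx
  | succ k ih =>
    rw [pow_succ, mul_smul] at hx
    exact ih x (I.eq_zero_of_prime_nsmul_eq_zero (p ^ k • x) (by rwa [smul_comm] at hx))

/-- **No `p`-torsion in `𝐇¹_Γ(T_pW)` as a `Λ = ℤ_p⟦T⟧`-module**: the constant power series
`C(p) ∈ Λ` is not a zero-divisor on `𝐇¹_Γ` (`proj_C_smul`: constants act through the `ℤ_p`-structure
of the levels). [cite: Kato2004Asterisque, Thm. 12.4 (2) (p. 222)] -/
theorem IwasawaH1Data.eq_zero_of_C_prime_smul_eq_zero (I : IwasawaH1Data W p κ γ) (x : I.H)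
    (hx : (PowerSeries.C (p : ℤ_[p]) : IwasawaAlgebra p) • x = 0) : x = 0 := by
  obtain ⟨n₀, hn₀⟩ := exists_forall_layerCores_eq_zero_of_prime_smul_eq_zero W p κ
  have htors : ∀ n, (p : ℤ_[p]) • I.proj n x = 0 := fun n ↦ by
    rw [← I.proj_C_smul (p : ℤ_[p]) n x, hx, map_zero]
  have hge : ∀ n, n₀ ≤ n → I.proj n x = 0 := fun n hn ↦ by
    rw [← I.cores_proj n x]
    exact hn₀ n hn _ (htors (n + 1))
  have hall : ∀ m n, n₀ ≤ n + m → I.proj n x = 0 := by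
    intro m
    induction m with
    | zero => exact fun n hn ↦ hge n (by simpa using hn)
    | succ m ih =>
      intro n hn
      rw [← I.cores_proj n x, ih (n + 1) (by omega), map_zero]
  exact I.proj_injective x fun n ↦ hall n₀ n (Nat.le_add_left n₀ n)

end Literature.NumberTheory.EllipticCurves.Kato2004

end
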